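import Summits.PneNP.PneNP.Theorems.SymmetryBudgetWindowCanoniserSemRoot

/-!
# Window canoniser, XVII: the state gates follow the mathematical replay

Route `PneNP/SymmetryBudget`, dichotomy `WindowBarrier` (stmt-PneNP-2145) / `NoHiddenOrder` (stmt-PneNP-14781);
continuation of `…WindowCanoniserSemRoot.lean`.  **`WCan.corr_rs`**: for every label `L`, input `x` and
`it ≤ T n`, the state gates of iteration `it` hold the replay state `WCan.rs L x it` (window of at least two
vertices).  Induction on `it`: the initial gates read the root refinement (`…SemRoot.lean`), and the next-state
formulas of the wiring are, gate by gate, the total formulas of `WCan.step` (flags: `…SemState.lean`; branching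
cell, selection, section move: `…SemCell.lean`; the refined colouring: `…SemRefine.lean`, transported off `W` by
`WCan.lt_crRefine_iff`).  Consequences for the final state: `WCan.ev_ok_iff` (the `ok` formula reads `okP`).
-/

-- `Summit.PneNP.PneNP.…` duplicates `PneNP` BY DESIGN (single-problem summit, D-0017 layout).
set_option linter.dupNamespace false

noncomputable section

namespace Summit.PneNP.PneNP.Theorems

namespace WCan

open Finset Literature.Computability.Complexity Literature.Computability.Complexity.CGCanon
  Literature.Computability.Complexity.ColourRefinementScheme Literature.Combinatorics.SimpleGraph
open scoped Classical

variable {K r n : ℕ}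

/-! ### The refined colouring, lifted off `W` -/

/-- Ordered refinement preserves strict inequalities of the input colouring. -/
theorem ocrIter_lt_of_lt {V : Type*} [Fintype V] (H : SimpleGraph V) [DecidableRel H.Adj] {col : V → ℕ} {u w : V}
    (huw : col u < col w) : ∀ t, ocrIter H col t u < ocrIter H col t w
  | 0 => huw
  | t + 1 => by rw [ocrIter_succ]; exact ocrStep_lt_of_lt (ocrIter_lt_of_lt H huw t)

/-- **The order of `crRefine G W c₁`, read as a lifted order**: outside `W` first, inside `W` by the refined colour. -/
theorem lt_crRefine_iff (G' : SimpleGraph (Fin n)) (W : Finset (Fin n)) (c₁ : Fin n → ℕ) (u w : Fin n) :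
    crRefine G' W c₁ u < crRefine G' W c₁ w ↔
      (u ∉ W ∧ w ∈ W) ∨ (u ∈ W ∧ w ∈ W ∧ crRefine G' W c₁ u < crRefine G' W c₁ w) := by
  by_cases hu : u ∈ W <;> by_cases hw : w ∈ W
  · simp [hu, hw]
  · simp only [hu, hw, not_true_eq_false, false_and, and_false, or_false, iff_false, not_lt]
    have : liftCol W c₁ w < liftCol W c₁ u := by rw [liftCol_of_not_mem _ hw, liftCol_of_mem _ hu]; omega
    exact (ocrIter_lt_of_lt _ this n).le
  · simp only [hu, hw, not_false_eq_true, and_self, false_and, or_false, iff_true]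
    have : liftCol W c₁ u < liftCol W c₁ w := by rw [liftCol_of_not_mem _ hu, liftCol_of_mem _ hw]; omega
    exact ocrIter_lt_of_lt _ this n
  · simp only [hu, hw, not_false_eq_true, and_false, false_and, or_self, iff_false, not_lt]
    exact (crRefine_eq_of_not_mem hw hu).le

/-! ### The induction -/

variable [NeZero n] (L : Lab K n) (x : Fin (r + n) × Fin (r + n) → Bool)

/-- **The initial gates hold the initial state.** -/
theorem corr_zero : Corr L x 0 (initSt x) := by
  refine ⟨fun v => ?_, fun u w => ?_, fun v => ?_, fun z => ?_, fun z => ?_⟩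
  · show Vl K x _ = _
    rw [Vl_eq]
    show (GateFn.and 1).2 (fun i => GateDAG.wire x (Vl K x) (Kind.argsR L .sW (prm (vec1 v) (it := ⟨0, Nat.succ_pos _⟩)) i)) = _
    simp only [GateFn.and, Kind.argsR, prm_it, Fin.forall_fin_one, wire_wA, ev_tt, initSt, mem_univ, decide_true]
  · show Vl K x _ = _
    rw [Vl_eq]
    show (GateFn.and 1).2 (fun i => GateDAG.wire x (Vl K x) (Kind.argsR L .sLT (prm (vec2 u w) (it := ⟨0, Nat.succ_pos _⟩)) i)) = _
    simp only [GateFn.and, Kind.argsR, prm_it, prm_vs, vec2_0, vec2_1, Fin.forall_fin_one, wire_wA, ev_aRLT_last, decide_eq_true_eq]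
    simp [St.liftLT, initSt]
  · show Vl K x _ = _
    rw [Vl_eq]
    show (GateFn.and 1).2 (fun i => GateDAG.wire x (Vl K x) (Kind.argsR L .sC (prm (vec1 v) (it := ⟨0, Nat.succ_pos _⟩)) i)) = _
    simp only [GateFn.and, Kind.argsR, prm_it, Fin.forall_fin_one, wire_wA, ev_ff, initSt, Finset.notMem_empty, decide_false]
    decide
  · show Vl K x _ = _
    rw [Vl_eq]
    show (GateFn.and 1).2 (fun i => GateDAG.wire x (Vl K x) (Kind.argsR L .sARR (prm (vec1 z) (it := ⟨0, Nat.succ_pos _⟩)) i)) = _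
    simp only [GateFn.and, Kind.argsR, prm_it, Fin.forall_fin_one, wire_wA, ev_ff, initSt]
    decide
  · show Vl K x _ = _
    rw [Vl_eq]
    show (GateFn.and 1).2 (fun i => GateDAG.wire x (Vl K x) (Kind.argsR L .sDEAD (prm (vec1 z) (it := ⟨0, Nat.succ_pos _⟩)) i)) = _
    simp only [GateFn.and, Kind.argsR, prm_it, Fin.forall_fin_one, wire_wA, ev_ff, initSt]
    decide

variable {L x} (hn : 2 ≤ n)
include hn

/-- **The step of the induction**: the gates of iteration `it + 1` hold `step (rs it)`. -/
theorem corr_succ {it : Fin (T n + 1)} {S : St n} (h : Corr L x it S) (hit : (it : ℕ) + 1 < T n + 1) :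
    Corr L x ⟨it + 1, hit⟩ (step L.1 x S) := by
  have hfrz := ev_aFrz (r := r) h
  have hconn := ev_aConn (r := r) h
  have hnWs := ev_aNWs (r := r) h
  have hsel := ev_aSel (r := r) h hn
  have hnow := ev_aNow (r := r) h
  have hcnt := ev_aCnt1 (r := r) h
  have hhas := ev_aHasSel (r := r) h hn
  have hpok := ev_aPok (r := r) h
  have hfLT := ev_aFLT_last (r := r) h hn
  have hit' : (⟨(it : ℕ), by omega⟩ : Fin (T n + 1)) = it := Fin.ext rfl
  refine ⟨fun v => ?_, fun u w => ?_, fun v => ?_, fun z => ?_, fun z => ?_⟩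
  · -- `W`
    apply Bool.eq_iff_iff.2
    show Vl K x _ = true ↔ _
    rw [Vl_eq]
    show (GateFn.and 1).2 (fun i => GateDAG.wire x (Vl K x) (Kind.argsR L .sW (prm (vec1 v) (it := ⟨it + 1, hit⟩)) i)) = true ↔ _
    simp only [GateFn.and, decide_eq_true_iff, Kind.argsR, prm_it, prm_vs, vec1_apply, Fin.forall_fin_one, wire_w2, hit']
    rw [Vl_n2and x _ (by simp)]
    simp only [List.mem_cons, List.not_mem_nil, or_false, forall_eq_or_imp, forall_eq, Vl_litN1, holds_pos, h.W, decide_eq_true_eq]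
    rw [Vl_n1or x _ (by simp)]
    simp only [List.mem_cons, List.not_mem_nil, or_false, exists_eq_or_imp, exists_eq_left, holds_pos, hfrz, hconn, hnWs,
      decide_eq_true_eq, step]
    by_cases hf : frzP L.1 S
    · simp [hf]
    · by_cases hc : IsConn (G x) S.W S.c
      · simp [hf, hc]
      · simp only [hf, hc, false_or, if_false, secW, mem_filter]
        tauto
  · -- `LT`
    apply Bool.eq_iff_iff.2
    show Vl K x _ = true ↔ _
    rw [Vl_eq]
    show (GateFn.and 1).2 (fun i => GateDAG.wire x (Vl K x) (Kind.argsR L .sLT (prm (vec2 u w) (it := ⟨it + 1, hit⟩)) i)) = true ↔ _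
    simp only [GateFn.and, decide_eq_true_iff, Kind.argsR, prm_it, prm_vs, vec2_0, vec2_1, Fin.forall_fin_one, wire_w2, hit']
    rw [Vl_n2or x _ (by simp)]
    simp only [List.mem_cons, List.not_mem_nil, or_false, exists_eq_or_imp, exists_eq_left]
    rw [Vl_n1and x _ (by simp), Vl_n1and x _ (by simp), Vl_n1and x _ (by simp), Vl_n1and x _ (by simp)]
    simp only [List.mem_cons, List.not_mem_nil, or_false, forall_eq_or_imp, forall_eq, holds_pos, holds_neg, hfrz, hconn, hnWs,
      h.LT, hfLT, decide_eq_true_eq, decide_eq_false_iff_not]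
    by_cases hf : frzP L.1 S
    · have : (step L.1 x S).liftLT u w ↔ S.liftLT u w := by simp [St.liftLT, step, hf]
      rw [this]; simp [hf]
    · by_cases hc : IsConn (G x) S.W S.c
      · have : (step L.1 x S).liftLT u w ↔ crRefine (G x) S.W (indCol L.1 S) u < crRefine (G x) S.W (indCol L.1 S) w := by
          rw [lt_crRefine_iff]; simp [St.liftLT, step, hf, hc]
        rw [this]; simp [hf, hc]
      · have : (step L.1 x S).liftLT u w ↔ (u ∉ secW L.1 x S ∧ w ∈ secW L.1 x S) ∨ (u ∈ secW L.1 x S ∧ w ∈ secW L.1 x S ∧ S.c u < S.c w) := by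
          simp [St.liftLT, step, hf, hc]
        rw [this]
        simp only [hf, hc, false_and, not_false_eq_true, true_and, false_or]
        have hsub : ∀ a, a ∈ secW L.1 x S → a ∈ S.W := fun a ha => (mem_filter.1 ha).1
        constructor
        · rintro (⟨hu, hw⟩ | ⟨hu, hw, hlt⟩)
          · exact Or.inl ⟨hu, hw⟩
          · exact Or.inr ⟨hu, hw, (S.liftLT_of_mem (hsub u hu) (hsub w hw)).1 hlt⟩
        · rintro (⟨hu, hw⟩ | ⟨hu, hw, hlt⟩)
          · exact Or.inl ⟨hu, hw⟩
          · exact Or.inr ⟨hu, hw, (S.liftLT_of_mem (hsub u hu) (hsub w hw)).2 hlt⟩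
  · -- `C`
    apply Bool.eq_iff_iff.2
    show Vl K x _ = true ↔ _
    rw [Vl_eq]
    show (GateFn.and 1).2 (fun i => GateDAG.wire x (Vl K x) (Kind.argsR L .sC (prm (vec1 v) (it := ⟨it + 1, hit⟩)) i)) = true ↔ _
    simp only [GateFn.and, decide_eq_true_iff, Kind.argsR, prm_it, prm_vs, vec1_apply, Fin.forall_fin_one, wire_w2, hit']
    rw [Vl_n2or x _ (by simp)]
    simp only [List.mem_cons, List.not_mem_nil, or_false, exists_eq_or_imp, exists_eq_left, Vl_litN1, holds_pos, h.C, decide_eq_true_eq]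
    rw [Vl_n1and x _ (by simp)]
    simp only [List.mem_cons, List.not_mem_nil, or_false, forall_eq_or_imp, forall_eq, holds_pos, holds_neg, hfrz, hconn, hsel,
      decide_eq_true_eq, decide_eq_false_iff_not, step]
    by_cases hf : frzP L.1 S
    · simp [hf]
    · by_cases hc : IsConn (G x) S.W S.c <;> simp [hf, hc]
  · -- `ARR`
    show Vl K x _ = _
    rw [Vl_eq]
    show (GateFn.and 1).2 (fun i => GateDAG.wire x (Vl K x) (Kind.argsR L .sARR (prm (vec1 z) (it := ⟨it + 1, hit⟩)) i)) = _
    simp only [GateFn.and, Kind.argsR, prm_it, prm_vs, vec1_apply, Fin.forall_fin_one, wire_w1, hit']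
    apply Bool.eq_iff_iff.2
    rw [decide_eq_true_iff, Vl_n1or x _ (by simp)]
    simp only [List.mem_cons, List.not_mem_nil, or_false, exists_eq_or_imp, exists_eq_left, holds_pos, h.arr, hnow,
      decide_eq_true_eq, step, Bool.or_eq_true]
  · -- `DEAD`
    show Vl K x _ = _
    rw [Vl_eq]
    show (GateFn.and 1).2 (fun i => GateDAG.wire x (Vl K x) (Kind.argsR L .sDEAD (prm (vec1 z) (it := ⟨it + 1, hit⟩)) i)) = _
    simp only [GateFn.and, Kind.argsR, prm_it, prm_vs, vec1_apply, Fin.forall_fin_one, wire_w2, hit']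
    apply Bool.eq_iff_iff.2
    rw [decide_eq_true_iff, Vl_n2or x _ (by simp)]
    simp only [List.mem_cons, List.not_mem_nil, or_false, exists_eq_or_imp, exists_eq_left, Vl_litN1, holds_pos, h.dead]
    rw [Vl_n1and x _ (by simp), Vl_n1and x _ (by simp), Vl_n1and x _ (by split_ifs <;> simp)]
    simp only [List.mem_cons, List.not_mem_nil, or_false, forall_eq_or_imp, forall_eq, holds_pos, holds_neg, hfrz, hconn, hcnt, hhas,
      decide_eq_true_eq, decide_eq_false_iff_not, step, Bool.or_eq_true]
    have hU : (∀ l ∈ ([neg (aFrz L it (r := r) z), neg (aConn L it (r := r) z)] ++ (if L.1.U = ∅ then [] else [neg (aPok L it (r := r) z)])),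
        Lit.Holds x l) ↔ (¬ frzP L.1 S ∧ ¬ IsConn (G x) S.W S.c ∧ ¬ pokP L.1 x S) := by
      by_cases h0 : L.1.U = ∅
      · simp only [h0, ↓reduceIte, List.append_nil, List.mem_cons, List.not_mem_nil, or_false, forall_eq_or_imp, forall_eq,
          holds_neg, hfrz, hconn, decide_eq_false_iff_not, pokP, Finset.not_nonempty_empty, and_false, not_false_eq_true, and_true]
      · simp only [h0, ↓reduceIte, List.mem_append, List.mem_cons, List.not_mem_nil, or_false, pokP]
        simp only [or_imp, forall_and, forall_eq, holds_neg, hfrz, hconn, hpok, decide_eq_false_iff_not,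
          Finset.nonempty_iff_ne_empty, ne_eq, h0, not_false_eq_true, and_true]
        tauto
    rw [hU]
    tauto

/-- **The state gates follow the replay**: iteration `it ≤ T n` holds `rs L x it`. -/
theorem corr_rs : ∀ (it : Fin (T n + 1)), Corr L x it (rs L.1 x it)
  | ⟨it, hit⟩ => by
    induction it with
    | zero => exact corr_zero L x
    | succ it ih =>
      rw [show rs L.1 x (it + 1) = step L.1 x (rs L.1 x it) from rs_succ L.1 x it]
      exact corr_succ hn (ih (by omega)) hit

/-- **The `ok` formula** (`ARR T ∧ ¬ DEAD T`) **reads `okP`.** -/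
theorem ok_iff (z : Fin n) : (ev x (aARR (r := r) L (tf n) z) = true ∧ ev x (aDEAD (r := r) L (tf n) z) = false) ↔ okP L.1 x := by
  have h := corr_rs (L := L) (x := x) hn (tf n)
  rw [h.arr, h.dead, okP]
  rfl

end WCan

end Summit.PneNP.PneNP.Theorems

end
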